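import Literature.AlgebraicGeometry.Frobenioids.BiratPathsDiv
import Literature.AlgebraicGeometry.Frobenioids.BiratPathsExist
import HarnessLib

/-!
# Frobenioids I, Theorem 5.2 (iv), proof step: the category `C′` of objects with `F_P`-paths and
the comparison functor `C′ → model`, modulo the unit entry

Mochizuki, *The geometry of Frobenioids I: the general theory*, Kyushu J. Math. **62** (2008)
293–400, §5, proof of Theorem 5.2 (iv), kurims text pp. 101–102 [cite: MochizukiFrdI2008, Thm.
5.2(iv) p.101]:
"Write `C′` for the category whose objects are objects of `C` equipped with an `F_P`-path, and whose
morphisms are the morphisms between the objects regarded as objects of `C`. … it suffices to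
construct
an equivalence of categories `C′ ⥲` [the model Frobenioid] … to every object … we may associate an
object `(Base(A), Φ(ζ_A)⁻¹(Div(ζ_C) − Div(ζ_A)))` … to any morphism `φ : C → C'` a morphism
`(deg_Fr(φ), Base(…), (Φ(ζ_A)⁻¹ ∘ Φ(ζ_C))(Div(φ)), {…}_{O^×})` … these assignments determine a
functor."

This file builds `C′` (`PathCat`, an induced category over `C`, so `C′ → C` is fully faithful) and
the
comparison functor `C′ → ModelFrobenioid Φ B Div_B` on the data `(deg_Fr φ, baseOf φ, divOf φ, u_φ)`
with objects `(Base A, cls p)` (`BiratPaths*.lean`), MODULO the fourth entry: the units `u_φ ∈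
B(A_D)`
enter as a datum `UnitData` subject to (a) `Div_B(u_φ) = Div(pathHom φ)` — which by `gpDiv_pathHom`
is exactly relation (d) of the model Frobenioid — and (b) the cocycle law of composition.  Producing
`UnitData` from the hypotheses of Thm. 5.2 (iv) (the `O^×`-part of the unique factorisation of
Remark 2.7.2 inside `E ⊆ C^birat`, read through the rational-function-monoid isomorphism `B ≅ O^×`)
and proving that the functor is an equivalence are the remaining steps.
-/

namespace Literature.AlgebraicGeometry.Frobenioids

open CategoryTheory Opposite

universe w v v' u u'

namespace PreFrobenioid

variable {D : Type u} [Category.{v} D] {Φ : Dᵒᵖ ⥤ CommMonCat.{w}}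
  {C : Type u'} [Category.{v'} C]

/-- **The unit entry as a datum.**  For the comparison functor `C′ → model` one needs, for every
morphism `φ` between objects with `F_P`-paths `p, p'`, a unit `u_φ ∈ B(A_D)` such that
(a) `Div_B(u_φ) = Div(pathHom φ)` in `Φ^gp(A_D)` (⟺ relation (d), by `gpDiv_pathHom`), (b) `u_{id}
= 1`
and (c) `u_{φ ≫ φ'} = B(baseOf φ)(u_{φ'}) · u_φ^{deg φ'}`.  In the proof of Thm. 5.2 (iv) this is
the
`O^×`-part of the factorisation of Remark 2.7.2 in `E ⊆ C^birat`, transported by `B ≅ O^×(−^birat)`.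
[cite: MochizukiFrdI2008, Thm. 5.2(iv) p.102] -/
structure UnitData {F : C ⥤ ElemFrobenioid Φ} (hF : IsFrobenioid F) (hsq : HasBiratSquares F)
    (P : Set C) (B : Dᵒᵖ ⥤ CommMonCat.{w}) (DivB : B ⟶ monoidGp Φ) :
    Type (max u' v' w) where
  /-- the units `u_φ ∈ B(A_D)` -/
  unit : ∀ {X X' : C} (p : FPPath F P X) (p' : FPPath F P X') (_ : X ⟶ X'),
    B.obj (op (baseObj F p.A))
  /-- (a) `Div_B(u_φ) = Div(pathHom φ)` -/
  divB_unit : ∀ {X X' : C} (p : FPPath F P X) (p' : FPPath F P X') (φ : X ⟶ X'),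
    divB Φ B DivB (op (baseObj F p.A)) (unit p p' φ) = Birat.gpDiv (FPPath.pathHom hF hsq p p' φ)
  /-- (b) identities -/
  unit_id : ∀ {X : C} (p : FPPath F P X), unit p p (𝟙 X) = 1
  /-- (c) composition (the cocycle law of the model Frobenioid) -/
  unit_comp : ∀ {X X' X'' : C} (p : FPPath F P X) (p' : FPPath F P X') (p'' : FPPath F P X'')
    (φ : X ⟶ X') (φ' : X' ⟶ X''), unit p p'' (φ ≫ φ') =
      (B.map (FPPath.baseOf p p' φ).op).hom (unit p' p'' φ') * unit p p' φ ^ (degFr F φ' : ℕ)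

namespace UnitData

variable {F : C ⥤ ElemFrobenioid Φ} {hF : IsFrobenioid F} {hsq : HasBiratSquares F} {P : Set C}
  {B : Dᵒᵖ ⥤ CommMonCat.{w}} {DivB : B ⟶ monoidGp Φ}

/-- The model object `(Base(A), cls p)` of an object with an `F_P`-path.
[cite: MochizukiFrdI2008, Thm. 5.2(iv) p.102] -/
noncomputable def objOf (x : PathCat F P) : ModelFrobenioid Φ B DivB :=
  ⟨baseObj F x.path.A, x.path.cls⟩

/-- The model morphism `(deg_Fr φ, baseOf φ, divOf φ, u_φ)` of `φ`; relation (d) holds by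
`gpDiv_pathHom` and (a). [cite: MochizukiFrdI2008, Thm. 5.2(iv) p.102] -/
noncomputable def homOf (U : UnitData hF hsq P B DivB) {x y : PathCat F P} (f : x ⟶ y) :
    (objOf x : ModelFrobenioid Φ B DivB) ⟶ objOf y where
  degFr := degFr F f.hom
  base := FPPath.baseOf x.path y.path f.hom
  div := FPPath.divOf x.path f.hom
  unit := U.unit x.path y.path f.hom
  rel := by
    change x.path.cls ^ (degFr F f.hom : ℕ) *
        Algebra.GrothendieckGroup.of (FPPath.divOf x.path f.hom) =
      pullGp Φ (FPPath.baseOf x.path y.path f.hom) y.path.cls *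
        divB Φ B DivB (op (baseObj F x.path.A)) (U.unit x.path y.path f.hom)
    rw [U.divB_unit]
    exact FPPath.gpDiv_pathHom x.path y.path f.hom

/-- **The comparison functor `C′ → model Frobenioid`** (modulo the unit data).
[cite: MochizukiFrdI2008, Thm. 5.2(iv) p.102] -/
noncomputable def comparison (U : UnitData hF hsq P B DivB) :
    PathCat F P ⥤ ModelFrobenioid Φ B DivB where
  obj := objOf
  map f := U.homOf f
  map_id x := by
    apply ModelFrobenioid.hom_ext
    · exact degFr_id F x.pt
    · exact FPPath.baseOf_id x.path
    · exact FPPath.divOf_id x.path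
    · exact U.unit_id x.path
  map_comp {x y z} f g := by
    apply ModelFrobenioid.hom_ext
    · change degFr F (f.hom ≫ g.hom) = degFr F g.hom * degFr F f.hom
      rw [degFr_comp, mul_comm]
    · exact FPPath.baseOf_comp x.path y.path z.path f.hom g.hom
    · exact FPPath.divOf_comp x.path y.path f.hom g.hom
    · exact U.unit_comp x.path y.path z.path f.hom g.hom

/-- The comparison functor is compatible with the projections to `D` up to the path base
isomorphisms: `Base(comparison φ) = baseOf φ = Base(ζ_{A'}) ∘ Base(ζ_{X'})⁻¹ ∘ Base(φ) ∘ Base(ζ_X)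
∘ Base(ζ_A)⁻¹`.
[cite: MochizukiFrdI2008, Thm. 5.2(iv) p.102] -/
theorem baseMap_comparison_map (U : UnitData hF hsq P B DivB) {x y : PathCat F P} (f : x ⟶ y) :
    ModelFrobenioid.baseMap ((comparison U).map f) = FPPath.baseOf x.path y.path f.hom := rfl

/-- `deg_Fr(comparison φ) = deg_Fr φ`. [cite: MochizukiFrdI2008, Thm. 5.2(iv) p.102] -/
theorem degFr_comparison_map (U : UnitData hF hsq P B DivB) {x y : PathCat F P} (f : x ⟶ y) :
    ModelFrobenioid.degFr ((comparison U).map f) = degFr F f.hom := rfl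

/-- `Div(comparison φ) = (Φ(ζ_A)⁻¹ ∘ Φ(ζ_X))(Div φ)`. [cite: MochizukiFrdI2008, Thm. 5.2(iv) p.102]
-/
theorem div_comparison_map (U : UnitData hF hsq P B DivB) {x y : PathCat F P} (f : x ⟶ y) :
    ModelFrobenioid.div ((comparison U).map f) = FPPath.divOf x.path f.hom := rfl

/-! ### 1-commutativity with the functors to `F_Φ` -/

/-- The base isomorphism of an `F_P`-path: `Base(ζ_A)⁻¹ ≫ Base(ζ_X) : Base A ≅ Base X`.
[cite: MochizukiFrdI2008, Thm. 5.2(iv) p.102] -/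
noncomputable def pathBaseIso {X : C} (p : FPPath F P X) : baseObj F p.A ≅ baseObj F X :=
  haveI : IsIso (Base F p.ζA) := p.ζA_mem.2.2
  haveI : IsIso (Base F p.ζX) := p.ζX_mem.2.2
  (asIso (Base F p.ζA)).symm ≪≫ asIso (Base F p.ζX)

/-- The isomorphism `(Base A, 0, 1) : Base(A) ≅ X` in `F_Φ` between the model image and the image
of `X`
under `C → F_Φ`. [cite: MochizukiFrdI2008, Thm. 5.2(iv) p.102] -/
noncomputable def pathElemIso {X : C} (p : FPPath F P X) :
    (ElemFrobenioid.of Φ (baseObj F p.A) : ElemFrobenioid Φ) ≅ F.obj X where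
  hom := ElemFrobenioid.homMk (A := ElemFrobenioid.of Φ (baseObj F p.A)) (B := F.obj X)
    (pathBaseIso p).hom 1 1
  inv := ElemFrobenioid.homMk (A := F.obj X) (B := ElemFrobenioid.of Φ (baseObj F p.A))
    (pathBaseIso p).inv 1 1
  hom_inv_id := by
    apply ElemFrobenioid.Hom.ext
    · exact (pathBaseIso p).hom_inv_id
    · change pull Φ (pathBaseIso p).hom 1 * 1 ^ ((1 : ℕ+) : ℕ) = 1
      rw [map_one, one_pow, mul_one]
    · rfl
  inv_hom_id := by
    apply ElemFrobenioid.Hom.ext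
    · exact (pathBaseIso p).inv_hom_id
    · change pull Φ (pathBaseIso p).inv 1 * 1 ^ ((1 : ℕ+) : ℕ) = 1
      rw [map_one, one_pow, mul_one]
    · rfl

/-- **1-commutativity** of the comparison functor with the functors to `F_Φ` ("compatible with the
functors `C′ → C → F_Φ`, [model] `→ F_Φ`"): `comparison ⋙ toElem ≅ forget ⋙ (C → F_Φ)`,
componentwise
the path isomorphisms `(Base(ζ_A)⁻¹ ≫ Base(ζ_X), 0, 1)`. [cite: MochizukiFrdI2008, Thm. 5.2(iv)
p.102] -/
noncomputable def comparisonToElemIso (U : UnitData hF hsq P B DivB) :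
    comparison U ⋙ ModelFrobenioid.toElem Φ B DivB ≅ PathCat.forget F P ⋙ F :=
  NatIso.ofComponents (fun x => pathElemIso x.path) (by
    intro x y f
    haveI : IsIso (Base F x.path.ζA) := x.path.ζA_mem.2.2
    haveI : IsIso (Base F x.path.ζX) := x.path.ζX_mem.2.2
    haveI : IsIso (Base F y.path.ζA) := y.path.ζA_mem.2.2
    haveI : IsIso (Base F y.path.ζX) := y.path.ζX_mem.2.2
    apply ElemFrobenioid.Hom.ext
    · change FPPath.baseOf x.path y.path f.hom ≫ (inv (Base F y.path.ζA) ≫ Base F y.path.ζX) =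
        (inv (Base F x.path.ζA) ≫ Base F x.path.ζX) ≫ Base F f.hom
      unfold FPPath.baseOf
      simp only [Category.assoc, IsIso.hom_inv_id_assoc, IsIso.inv_hom_id, Category.comp_id]
      rfl
    · change pull Φ (FPPath.baseOf x.path y.path f.hom) 1 *
          FPPath.divOf x.path f.hom ^ ((1 : ℕ+) : ℕ) =
        pull Φ (inv (Base F x.path.ζA) ≫ Base F x.path.ζX) (Div F f.hom) * 1 ^ (degFr F f.hom : ℕ)
      rw [map_one, one_mul, PNat.one_coe, pow_one, one_pow, mul_one]
      unfold FPPath.divOf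
      rw [← pull_comp]
    · change degFr F f.hom * 1 = 1 * degFr F f.hom
      rw [mul_one, one_mul])

/-- Hence `OneCommutes comparison toElem forget (C → F_Φ)`. [cite: MochizukiFrdI2008, Thm. 5.2(iv)
p.102] -/
theorem comparison_oneCommutes (U : UnitData hF hsq P B DivB) :
    OneCommutes (comparison U) (ModelFrobenioid.toElem Φ B DivB) (PathCat.forget F P) F :=
  ⟨comparisonToElemIso U⟩

end UnitData

end PreFrobenioid

end Literature.AlgebraicGeometry.Frobenioids
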